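import Summits.BirchSwinnertonDyer.BirchSwinnertonDyer.Theorems.ManinLocalTwoThreeEulerRemaindersForty
import Literature.Combinatorics.Enumerative.EulerPentagonalPowerSeries
import HarnessLib

/-!
# The Euler functions at level 56: `E₁`, `E₇` modulo `o(q¹⁴)`, `E₂`, `E₄`, `E₈`, `E₁₄`, `E₂₈` modulo `o(q³²)`, and the derivatives of
# `E₂`, `E₄`, `E₈` modulo `o(q¹²)`

Cell bsd-f2-manin, route `ManinLocalTwoThree` (crux C2 `ManinOddAtFour`, stmt-22967: `2² ∣ 56`), prover seat p2 gen 28; the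
level-`56` analogue of `EulerRemaindersForty` / `EulerRemaindersFortyEight` — toolkit for the newform pinning at `56` (two newforms
`56a = P − Q`, `56b = P + Q`) and for the `η`-identities of `X₀(56) → 56a1`, `X₀(56) → 56b1` (`56 = 2³·7`, genus `g(X₀(56)) = 5`).
With `E_δ(τ) = ∏_{n ≥ 1} (1 − q^{δn})` (`eulerFn δ`), `q = e^{2πiτ}`, in the remainder language of `QRemainderCalculus`:

* the coefficients `0, …, 16` of `∏(1 − Xⁿ)` from the tree's formal PENTAGONAL NUMBER THEOREM
  (`Literature.Combinatorics.Enumerative.EulerPentagonal.coeff_prod_one_sub_X_pow_eq_coeff_partialSum`), hence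
  `E₁ = 1 − q − q² + q⁵ + q⁷ − q¹² + o(q¹⁴)`, `E₇ = 1 − q⁷ − q¹⁴ + o(q¹⁴)`, `E₂ = 1 − q² − q⁴ + q¹⁰ + q¹⁴ − q²⁴ − q³⁰ + o(q³²)`,
  `E₄ = 1 − q⁴ − q⁸ + q²⁰ + q²⁸ + o(q³²)`, `E₈ = 1 − q⁸ − q¹⁶ + o(q³²)`, `E₁₄ = 1 − q¹⁴ − q²⁸ + o(q³²)`, `E₂₈ = 1 − q²⁸ + o(q³²)`,
  and `(2πi)⁻¹E₂′ = −2q² − 4q⁴ + 10q¹⁰ + o(q¹²)`, `(2πi)⁻¹E₄′ = −4q⁴ − 8q⁸ + o(q¹²)`, `(2πi)⁻¹E₈′ = −8q⁸ + o(q¹²)`;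
* the sequel `EtaMonomialsFiftySix` writes the level-`56` `η`-quotients `U`, `V`, `P`, `Q` as `q`-monomials times Euler functions.

No definition, no named fact, no sorry; nothing here proves C2, Manin's conjecture or BSD. [cite: HardyWright2008, §19.9 Thm 353]
[cite: CremonaAlgorithms1997, Table 3 (N = 56)] -/

set_option autoImplicit false
-- lint-debt: the directory name repeats the summit name (sibling precedent `ManinLocalTwoThreeEulerRemaindersForty.lean`)
set_option linter.dupNamespace false

noncomputable section

open Complex Filter Topology Set Asymptotics Polynomial
open UpperHalfPlane hiding I
open scoped Real Topology Manifold MatrixGroups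
open Literature.NumberTheory.EllipticCurves Literature.NumberTheory.EllipticCurves.ModularForms

namespace Summit.BirchSwinnertonDyer.BirchSwinnertonDyer.Theorems.ManinLocalTwoThree.EulerRemaindersFiftySix

open QRemainder EulerRemainders
open LigozatIdentities (hasDerivAt_eulerFn_comp)
open EulerRemaindersSixtyFour (cexp_eq_qParam_pow)

/-! ## §1 Euler functions and their derivatives, truncated -/

/-- `∏_{n ≥ 1} (1 − Xⁿ) = 1 − X − X² + X⁵ + X⁷ − X¹² − X¹⁵ + ⋯` (Euler's pentagonal number theorem, from the tree's formal Shanks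
identity `coeff_prod_one_sub_X_pow_eq_coeff_partialSum`): the coefficients `0, …, 16`. [cite: HardyWright2008, §19.9 Thm 353] -/
theorem coeff_formalEulerPow_one_le_sixteen (n : ℕ) (hn : n ≤ 16) :
    PowerSeries.coeff n (formalEulerPow 1)
      = if n = 0 then 1 else if n = 1 then -1 else if n = 2 then -1 else if n = 5 then 1 else if n = 7 then 1
        else if n = 12 then -1 else if n = 15 then -1 else 0 := by
  rw [coeff_formalEulerPow hn, eulerTrunc]
  simp only [pow_one]
  rw [Literature.Combinatorics.Enumerative.EulerPentagonal.coeff_prod_one_sub_X_pow_eq_coeff_partialSum (R := ℤ) hn]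
  simp only [Finset.sum_range_succ, Finset.sum_range_zero]
  norm_num
  interval_cases n <;> simp [PowerSeries.coeff_X]

/-- The `q`-coefficients `0, …, 14` of `E₁` (`1 - q - q ^ 2 + q ^ 5 + q ^ 7 - q ^ 12`). [folklore] -/
theorem coeff_formalEulerScaled_one_le_fourteen (n : ℕ) (hn : n ≤ 14) :
    PowerSeries.coeff n (formalEulerScaled 1) = if n = 0 then 1 else if n = 1 then -1 else if n = 2 then -1 else if n = 5 then 1 else if n = 7 then 1 else if n = 12 then -1 else 0 := by
  have h0 := coeff_formalEulerPow_one_le_sixteen 0 (by norm_num) 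
  have h1 := coeff_formalEulerPow_one_le_sixteen 1 (by norm_num) 
  have h2 := coeff_formalEulerPow_one_le_sixteen 2 (by norm_num) 
  have h3 := coeff_formalEulerPow_one_le_sixteen 3 (by norm_num) 
  have h4 := coeff_formalEulerPow_one_le_sixteen 4 (by norm_num) 
  have h5 := coeff_formalEulerPow_one_le_sixteen 5 (by norm_num) 
  have h6 := coeff_formalEulerPow_one_le_sixteen 6 (by norm_num) 
  have h7 := coeff_formalEulerPow_one_le_sixteen 7 (by norm_num) 
  have h8 := coeff_formalEulerPow_one_le_sixteen 8 (by norm_num) 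
  have h9 := coeff_formalEulerPow_one_le_sixteen 9 (by norm_num) 
  have h10 := coeff_formalEulerPow_one_le_sixteen 10 (by norm_num) 
  have h11 := coeff_formalEulerPow_one_le_sixteen 11 (by norm_num) 
  have h12 := coeff_formalEulerPow_one_le_sixteen 12 (by norm_num) 
  have h13 := coeff_formalEulerPow_one_le_sixteen 13 (by norm_num) 
  have h14 := coeff_formalEulerPow_one_le_sixteen 14 (by norm_num)
  simp only at h0 h1 h2 h3 h4 h5 h6 h7 h8 h9 h10 h11 h12 h13 h14
  interval_cases n <;> simp +decide [coeff_formalEulerScaled, h0, h1, h2, h3, h4, h5, h6, h7, h8, h9, h10, h11, h12, h13, h14]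

/-- **`E₁ = 1 - q - q ^ 2 + q ^ 5 + q ^ 7 - q ^ 12 + o(q¹⁴)`.** [folklore] -/
theorem tendsto_eulerFn_one_fourteen :
    Tendsto (fun τ : ℍ ↦ (eulerFn 1 τ - (1 - X - X ^ 2 + X ^ 5 + X ^ 7 - X ^ 12 : ℂ[X]).eval (Function.Periodic.qParam 1 (τ : ℂ)))
      / Function.Periodic.qParam 1 (τ : ℂ) ^ 14) atImInfty (𝓝 0) := by
  refine congr_poly ?_ (tendsto_of_hasSum (periodic_eulerFn 1) (mdifferentiable_eulerFn 1)
    (isBoundedAtImInfty_eulerFn (by norm_num)) (hasSum_eulerFn (by norm_num)) 14)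
  have h := coeff_formalEulerScaled_one_le_fourteen
  simp only [Finset.sum_range_succ, Finset.sum_range_zero, h 0 (by norm_num), h 1 (by norm_num), h 2 (by norm_num), h 3 (by norm_num), h 4 (by norm_num), h 5 (by norm_num), h 6 (by norm_num), h 7 (by norm_num), h 8 (by norm_num), h 9 (by norm_num), h 10 (by norm_num), h 11 (by norm_num), h 12 (by norm_num), h 13 (by norm_num), h 14 (by norm_num)]
  norm_num
  ring

/-- The `q`-coefficients `0, …, 14` of `E₇` (`1 - q ^ 7 - q ^ 14`). [folklore] -/
theorem coeff_formalEulerScaled_seven_le_fourteen (n : ℕ) (hn : n ≤ 14) :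
    PowerSeries.coeff n (formalEulerScaled 7) = if n = 0 then 1 else if n = 7 then -1 else if n = 14 then -1 else 0 := by
  have h0 := coeff_formalEulerPow_one_le_sixteen 0 (by norm_num) 
  have h1 := coeff_formalEulerPow_one_le_sixteen 1 (by norm_num) 
  have h2 := coeff_formalEulerPow_one_le_sixteen 2 (by norm_num)
  simp only at h0 h1 h2
  interval_cases n <;> simp +decide [coeff_formalEulerScaled, h0, h1, h2]

/-- **`E₇ = 1 - q ^ 7 - q ^ 14 + o(q¹⁴)`.** [folklore] -/
theorem tendsto_eulerFn_seven_fourteen :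
    Tendsto (fun τ : ℍ ↦ (eulerFn 7 τ - (1 - X ^ 7 - X ^ 14 : ℂ[X]).eval (Function.Periodic.qParam 1 (τ : ℂ)))
      / Function.Periodic.qParam 1 (τ : ℂ) ^ 14) atImInfty (𝓝 0) := by
  refine congr_poly ?_ (tendsto_of_hasSum (periodic_eulerFn 7) (mdifferentiable_eulerFn 7)
    (isBoundedAtImInfty_eulerFn (by norm_num)) (hasSum_eulerFn (by norm_num)) 14)
  have h := coeff_formalEulerScaled_seven_le_fourteen
  simp only [Finset.sum_range_succ, Finset.sum_range_zero, h 0 (by norm_num), h 1 (by norm_num), h 2 (by norm_num), h 3 (by norm_num), h 4 (by norm_num), h 5 (by norm_num), h 6 (by norm_num), h 7 (by norm_num), h 8 (by norm_num), h 9 (by norm_num), h 10 (by norm_num), h 11 (by norm_num), h 12 (by norm_num), h 13 (by norm_num), h 14 (by norm_num)]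
  norm_num
  ring

/-- The `q`-coefficients `0, …, 32` of `E₂` (`1 - q ^ 2 - q ^ 4 + q ^ 10 + q ^ 14 - q ^ 24 - q ^ 30`). [folklore] -/
theorem coeff_formalEulerScaled_two_le_thirtyTwo (n : ℕ) (hn : n ≤ 32) :
    PowerSeries.coeff n (formalEulerScaled 2) = if n = 0 then 1 else if n = 2 then -1 else if n = 4 then -1 else if n = 10 then 1 else if n = 14 then 1 else if n = 24 then -1 else if n = 30 then -1 else 0 := by
  have h0 := coeff_formalEulerPow_one_le_sixteen 0 (by norm_num) 
  have h1 := coeff_formalEulerPow_one_le_sixteen 1 (by norm_num) 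
  have h2 := coeff_formalEulerPow_one_le_sixteen 2 (by norm_num) 
  have h3 := coeff_formalEulerPow_one_le_sixteen 3 (by norm_num) 
  have h4 := coeff_formalEulerPow_one_le_sixteen 4 (by norm_num) 
  have h5 := coeff_formalEulerPow_one_le_sixteen 5 (by norm_num) 
  have h6 := coeff_formalEulerPow_one_le_sixteen 6 (by norm_num) 
  have h7 := coeff_formalEulerPow_one_le_sixteen 7 (by norm_num) 
  have h8 := coeff_formalEulerPow_one_le_sixteen 8 (by norm_num) 
  have h9 := coeff_formalEulerPow_one_le_sixteen 9 (by norm_num) 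
  have h10 := coeff_formalEulerPow_one_le_sixteen 10 (by norm_num) 
  have h11 := coeff_formalEulerPow_one_le_sixteen 11 (by norm_num) 
  have h12 := coeff_formalEulerPow_one_le_sixteen 12 (by norm_num) 
  have h13 := coeff_formalEulerPow_one_le_sixteen 13 (by norm_num) 
  have h14 := coeff_formalEulerPow_one_le_sixteen 14 (by norm_num) 
  have h15 := coeff_formalEulerPow_one_le_sixteen 15 (by norm_num) 
  have h16 := coeff_formalEulerPow_one_le_sixteen 16 (by norm_num)
  simp only at h0 h1 h2 h3 h4 h5 h6 h7 h8 h9 h10 h11 h12 h13 h14 h15 h16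
  interval_cases n <;> simp +decide [coeff_formalEulerScaled, h0, h1, h2, h3, h4, h5, h6, h7, h8, h9, h10, h11, h12, h13, h14, h15, h16]

/-- **`E₂ = 1 - q ^ 2 - q ^ 4 + q ^ 10 + q ^ 14 - q ^ 24 - q ^ 30 + o(q³²)`.** [folklore] -/
theorem tendsto_eulerFn_two_thirtyTwo :
    Tendsto (fun τ : ℍ ↦ (eulerFn 2 τ - (1 - X ^ 2 - X ^ 4 + X ^ 10 + X ^ 14 - X ^ 24 - X ^ 30 : ℂ[X]).eval (Function.Periodic.qParam 1 (τ : ℂ)))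
      / Function.Periodic.qParam 1 (τ : ℂ) ^ 32) atImInfty (𝓝 0) := by
  refine congr_poly ?_ (tendsto_of_hasSum (periodic_eulerFn 2) (mdifferentiable_eulerFn 2)
    (isBoundedAtImInfty_eulerFn (by norm_num)) (hasSum_eulerFn (by norm_num)) 32)
  have h := coeff_formalEulerScaled_two_le_thirtyTwo
  simp only [Finset.sum_range_succ, Finset.sum_range_zero, h 0 (by norm_num), h 1 (by norm_num), h 2 (by norm_num), h 3 (by norm_num), h 4 (by norm_num), h 5 (by norm_num), h 6 (by norm_num), h 7 (by norm_num), h 8 (by norm_num), h 9 (by norm_num), h 10 (by norm_num), h 11 (by norm_num), h 12 (by norm_num), h 13 (by norm_num), h 14 (by norm_num), h 15 (by norm_num), h 16 (by norm_num), h 17 (by norm_num), h 18 (by norm_num), h 19 (by norm_num), h 20 (by norm_num), h 21 (by norm_num), h 22 (by norm_num), h 23 (by norm_num), h 24 (by norm_num), h 25 (by norm_num), h 26 (by norm_num), h 27 (by norm_num), h 28 (by norm_num), h 29 (by norm_num), h 30 (by norm_num), h 31 (by norm_num), h 32 (by norm_num)]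
  norm_num
  ring

/-- The `q`-coefficients `0, …, 32` of `E₄` (`1 - q ^ 4 - q ^ 8 + q ^ 20 + q ^ 28`). [folklore] -/
theorem coeff_formalEulerScaled_four_le_thirtyTwo (n : ℕ) (hn : n ≤ 32) :
    PowerSeries.coeff n (formalEulerScaled 4) = if n = 0 then 1 else if n = 4 then -1 else if n = 8 then -1 else if n = 20 then 1 else if n = 28 then 1 else 0 := by
  have h0 := coeff_formalEulerPow_one_le_sixteen 0 (by norm_num) 
  have h1 := coeff_formalEulerPow_one_le_sixteen 1 (by norm_num) 
  have h2 := coeff_formalEulerPow_one_le_sixteen 2 (by norm_num) 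
  have h3 := coeff_formalEulerPow_one_le_sixteen 3 (by norm_num) 
  have h4 := coeff_formalEulerPow_one_le_sixteen 4 (by norm_num) 
  have h5 := coeff_formalEulerPow_one_le_sixteen 5 (by norm_num) 
  have h6 := coeff_formalEulerPow_one_le_sixteen 6 (by norm_num) 
  have h7 := coeff_formalEulerPow_one_le_sixteen 7 (by norm_num) 
  have h8 := coeff_formalEulerPow_one_le_sixteen 8 (by norm_num)
  simp only at h0 h1 h2 h3 h4 h5 h6 h7 h8
  interval_cases n <;> simp +decide [coeff_formalEulerScaled, h0, h1, h2, h3, h4, h5, h6, h7, h8]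

/-- **`E₄ = 1 - q ^ 4 - q ^ 8 + q ^ 20 + q ^ 28 + o(q³²)`.** [folklore] -/
theorem tendsto_eulerFn_four_thirtyTwo :
    Tendsto (fun τ : ℍ ↦ (eulerFn 4 τ - (1 - X ^ 4 - X ^ 8 + X ^ 20 + X ^ 28 : ℂ[X]).eval (Function.Periodic.qParam 1 (τ : ℂ)))
      / Function.Periodic.qParam 1 (τ : ℂ) ^ 32) atImInfty (𝓝 0) := by
  refine congr_poly ?_ (tendsto_of_hasSum (periodic_eulerFn 4) (mdifferentiable_eulerFn 4)
    (isBoundedAtImInfty_eulerFn (by norm_num)) (hasSum_eulerFn (by norm_num)) 32)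
  have h := coeff_formalEulerScaled_four_le_thirtyTwo
  simp only [Finset.sum_range_succ, Finset.sum_range_zero, h 0 (by norm_num), h 1 (by norm_num), h 2 (by norm_num), h 3 (by norm_num), h 4 (by norm_num), h 5 (by norm_num), h 6 (by norm_num), h 7 (by norm_num), h 8 (by norm_num), h 9 (by norm_num), h 10 (by norm_num), h 11 (by norm_num), h 12 (by norm_num), h 13 (by norm_num), h 14 (by norm_num), h 15 (by norm_num), h 16 (by norm_num), h 17 (by norm_num), h 18 (by norm_num), h 19 (by norm_num), h 20 (by norm_num), h 21 (by norm_num), h 22 (by norm_num), h 23 (by norm_num), h 24 (by norm_num), h 25 (by norm_num), h 26 (by norm_num), h 27 (by norm_num), h 28 (by norm_num), h 29 (by norm_num), h 30 (by norm_num), h 31 (by norm_num), h 32 (by norm_num)]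
  norm_num
  ring

/-- The `q`-coefficients `0, …, 32` of `E₈` (`1 - q ^ 8 - q ^ 16`). [folklore] -/
theorem coeff_formalEulerScaled_eight_le_thirtyTwo (n : ℕ) (hn : n ≤ 32) :
    PowerSeries.coeff n (formalEulerScaled 8) = if n = 0 then 1 else if n = 8 then -1 else if n = 16 then -1 else 0 := by
  have h0 := coeff_formalEulerPow_one_le_sixteen 0 (by norm_num) 
  have h1 := coeff_formalEulerPow_one_le_sixteen 1 (by norm_num) 
  have h2 := coeff_formalEulerPow_one_le_sixteen 2 (by norm_num) 
  have h3 := coeff_formalEulerPow_one_le_sixteen 3 (by norm_num) 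
  have h4 := coeff_formalEulerPow_one_le_sixteen 4 (by norm_num)
  simp only at h0 h1 h2 h3 h4
  interval_cases n <;> simp +decide [coeff_formalEulerScaled, h0, h1, h2, h3, h4]

/-- **`E₈ = 1 - q ^ 8 - q ^ 16 + o(q³²)`.** [folklore] -/
theorem tendsto_eulerFn_eight_thirtyTwo :
    Tendsto (fun τ : ℍ ↦ (eulerFn 8 τ - (1 - X ^ 8 - X ^ 16 : ℂ[X]).eval (Function.Periodic.qParam 1 (τ : ℂ)))
      / Function.Periodic.qParam 1 (τ : ℂ) ^ 32) atImInfty (𝓝 0) := by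
  refine congr_poly ?_ (tendsto_of_hasSum (periodic_eulerFn 8) (mdifferentiable_eulerFn 8)
    (isBoundedAtImInfty_eulerFn (by norm_num)) (hasSum_eulerFn (by norm_num)) 32)
  have h := coeff_formalEulerScaled_eight_le_thirtyTwo
  simp only [Finset.sum_range_succ, Finset.sum_range_zero, h 0 (by norm_num), h 1 (by norm_num), h 2 (by norm_num), h 3 (by norm_num), h 4 (by norm_num), h 5 (by norm_num), h 6 (by norm_num), h 7 (by norm_num), h 8 (by norm_num), h 9 (by norm_num), h 10 (by norm_num), h 11 (by norm_num), h 12 (by norm_num), h 13 (by norm_num), h 14 (by norm_num), h 15 (by norm_num), h 16 (by norm_num), h 17 (by norm_num), h 18 (by norm_num), h 19 (by norm_num), h 20 (by norm_num), h 21 (by norm_num), h 22 (by norm_num), h 23 (by norm_num), h 24 (by norm_num), h 25 (by norm_num), h 26 (by norm_num), h 27 (by norm_num), h 28 (by norm_num), h 29 (by norm_num), h 30 (by norm_num), h 31 (by norm_num), h 32 (by norm_num)]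
  norm_num
  ring

/-- The `q`-coefficients `0, …, 32` of `E₁₄` (`1 - q ^ 14 - q ^ 28`). [folklore] -/
theorem coeff_formalEulerScaled_fourteen_le_thirtyTwo (n : ℕ) (hn : n ≤ 32) :
    PowerSeries.coeff n (formalEulerScaled 14) = if n = 0 then 1 else if n = 14 then -1 else if n = 28 then -1 else 0 := by
  have h0 := coeff_formalEulerPow_one_le_sixteen 0 (by norm_num) 
  have h1 := coeff_formalEulerPow_one_le_sixteen 1 (by norm_num) 
  have h2 := coeff_formalEulerPow_one_le_sixteen 2 (by norm_num)
  simp only at h0 h1 h2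
  interval_cases n <;> simp +decide [coeff_formalEulerScaled, h0, h1, h2]

/-- **`E₁₄ = 1 - q ^ 14 - q ^ 28 + o(q³²)`.** [folklore] -/
theorem tendsto_eulerFn_fourteen_thirtyTwo :
    Tendsto (fun τ : ℍ ↦ (eulerFn 14 τ - (1 - X ^ 14 - X ^ 28 : ℂ[X]).eval (Function.Periodic.qParam 1 (τ : ℂ)))
      / Function.Periodic.qParam 1 (τ : ℂ) ^ 32) atImInfty (𝓝 0) := by
  refine congr_poly ?_ (tendsto_of_hasSum (periodic_eulerFn 14) (mdifferentiable_eulerFn 14)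
    (isBoundedAtImInfty_eulerFn (by norm_num)) (hasSum_eulerFn (by norm_num)) 32)
  have h := coeff_formalEulerScaled_fourteen_le_thirtyTwo
  simp only [Finset.sum_range_succ, Finset.sum_range_zero, h 0 (by norm_num), h 1 (by norm_num), h 2 (by norm_num), h 3 (by norm_num), h 4 (by norm_num), h 5 (by norm_num), h 6 (by norm_num), h 7 (by norm_num), h 8 (by norm_num), h 9 (by norm_num), h 10 (by norm_num), h 11 (by norm_num), h 12 (by norm_num), h 13 (by norm_num), h 14 (by norm_num), h 15 (by norm_num), h 16 (by norm_num), h 17 (by norm_num), h 18 (by norm_num), h 19 (by norm_num), h 20 (by norm_num), h 21 (by norm_num), h 22 (by norm_num), h 23 (by norm_num), h 24 (by norm_num), h 25 (by norm_num), h 26 (by norm_num), h 27 (by norm_num), h 28 (by norm_num), h 29 (by norm_num), h 30 (by norm_num), h 31 (by norm_num), h 32 (by norm_num)]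
  norm_num
  ring

/-- The `q`-coefficients `0, …, 32` of `E₂₈` (`1 - q ^ 28`). [folklore] -/
theorem coeff_formalEulerScaled_twentyEight_le_thirtyTwo (n : ℕ) (hn : n ≤ 32) :
    PowerSeries.coeff n (formalEulerScaled 28) = if n = 0 then 1 else if n = 28 then -1 else 0 := by
  have h0 := coeff_formalEulerPow_one_le_sixteen 0 (by norm_num) 
  have h1 := coeff_formalEulerPow_one_le_sixteen 1 (by norm_num)
  simp only at h0 h1
  interval_cases n <;> simp +decide [coeff_formalEulerScaled, h0, h1]

/-- **`E₂₈ = 1 - q ^ 28 + o(q³²)`.** [folklore] -/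
theorem tendsto_eulerFn_twentyEight_thirtyTwo :
    Tendsto (fun τ : ℍ ↦ (eulerFn 28 τ - (1 - X ^ 28 : ℂ[X]).eval (Function.Periodic.qParam 1 (τ : ℂ)))
      / Function.Periodic.qParam 1 (τ : ℂ) ^ 32) atImInfty (𝓝 0) := by
  refine congr_poly ?_ (tendsto_of_hasSum (periodic_eulerFn 28) (mdifferentiable_eulerFn 28)
    (isBoundedAtImInfty_eulerFn (by norm_num)) (hasSum_eulerFn (by norm_num)) 32)
  have h := coeff_formalEulerScaled_twentyEight_le_thirtyTwo
  simp only [Finset.sum_range_succ, Finset.sum_range_zero, h 0 (by norm_num), h 1 (by norm_num), h 2 (by norm_num), h 3 (by norm_num), h 4 (by norm_num), h 5 (by norm_num), h 6 (by norm_num), h 7 (by norm_num), h 8 (by norm_num), h 9 (by norm_num), h 10 (by norm_num), h 11 (by norm_num), h 12 (by norm_num), h 13 (by norm_num), h 14 (by norm_num), h 15 (by norm_num), h 16 (by norm_num), h 17 (by norm_num), h 18 (by norm_num), h 19 (by norm_num), h 20 (by norm_num), h 21 (by norm_num), h 22 (by norm_num), h 23 (by norm_num), h 24 (by norm_num), h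 25 (by norm_num), h 26 (by norm_num), h 27 (by norm_num), h 28 (by norm_num), h 29 (by norm_num), h 30 (by norm_num), h 31 (by norm_num), h 32 (by norm_num)]
  norm_num
  ring

/-- **`E₂′ = 2πi(-2 * q ^ 2 - 4 * q ^ 4 + 10 * q ^ 10) + o(q¹²)`.** [folklore] -/
theorem tendsto_deriv_eulerFn_two_twelve :
    Tendsto (fun τ : ℍ ↦ (deriv (eulerFn 2 ∘ ofComplex) τ
      - (C (2 * π * I) * (-2 * X ^ 2 - 4 * X ^ 4 + 10 * X ^ 10) : ℂ[X]).eval (Function.Periodic.qParam 1 (τ : ℂ)))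
      / Function.Periodic.qParam 1 (τ : ℂ) ^ 12) atImInfty (𝓝 0) := by
  refine congr_poly ?_ (congr_fun (fun τ ↦ deriv_eulerFn_sub_one 2 τ)
    (tendsto_deriv_of_isCuspFunction (isCuspFunction_eulerFn_sub_one (by norm_num : 0 < 2)) 12))
  have h := coeff_formalEulerScaled_two_le_thirtyTwo
  have hc : ∀ n : ℕ, n ≠ 0 → n ≤ 12 → (qExpansion 1 (eulerFn 2 - 1)).coeff n
      = (((if n = 0 then 1 else if n = 2 then -1 else if n = 4 then -1 else if n = 10 then 1 else if n = 14 then 1 else if n = 24 then -1 else if n = 30 then -1 else 0 : ℤ)) : ℂ) :=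
    fun n hn hnM ↦ by rw [qExpansion_eulerFn_sub_one_coeff_of_ne_zero (by norm_num) hn, h n (by omega)]
  simp only [Finset.sum_range_succ, Finset.sum_range_zero, hc 1 (by norm_num) (by norm_num),
    hc 2 (by norm_num) (by norm_num),
    hc 3 (by norm_num) (by norm_num),
    hc 4 (by norm_num) (by norm_num),
    hc 5 (by norm_num) (by norm_num),
    hc 6 (by norm_num) (by norm_num),
    hc 7 (by norm_num) (by norm_num),
    hc 8 (by norm_num) (by norm_num),
    hc 9 (by norm_num) (by norm_num),
    hc 10 (by norm_num) (by norm_num),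
    hc 11 (by norm_num) (by norm_num),
    hc 12 (by norm_num) (by norm_num)]
  norm_num
  simp only [map_ofNat]
  ring

/-- **`E₄′ = 2πi(-4 * q ^ 4 - 8 * q ^ 8) + o(q¹²)`.** [folklore] -/
theorem tendsto_deriv_eulerFn_four_twelve :
    Tendsto (fun τ : ℍ ↦ (deriv (eulerFn 4 ∘ ofComplex) τ
      - (C (2 * π * I) * (-4 * X ^ 4 - 8 * X ^ 8) : ℂ[X]).eval (Function.Periodic.qParam 1 (τ : ℂ)))
      / Function.Periodic.qParam 1 (τ : ℂ) ^ 12) atImInfty (𝓝 0) := by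
  refine congr_poly ?_ (congr_fun (fun τ ↦ deriv_eulerFn_sub_one 4 τ)
    (tendsto_deriv_of_isCuspFunction (isCuspFunction_eulerFn_sub_one (by norm_num : 0 < 4)) 12))
  have h := coeff_formalEulerScaled_four_le_thirtyTwo
  have hc : ∀ n : ℕ, n ≠ 0 → n ≤ 12 → (qExpansion 1 (eulerFn 4 - 1)).coeff n
      = (((if n = 0 then 1 else if n = 4 then -1 else if n = 8 then -1 else if n = 20 then 1 else if n = 28 then 1 else 0 : ℤ)) : ℂ) :=
    fun n hn hnM ↦ by rw [qExpansion_eulerFn_sub_one_coeff_of_ne_zero (by norm_num) hn, h n (by omega)]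
  simp only [Finset.sum_range_succ, Finset.sum_range_zero, hc 1 (by norm_num) (by norm_num),
    hc 2 (by norm_num) (by norm_num),
    hc 3 (by norm_num) (by norm_num),
    hc 4 (by norm_num) (by norm_num),
    hc 5 (by norm_num) (by norm_num),
    hc 6 (by norm_num) (by norm_num),
    hc 7 (by norm_num) (by norm_num),
    hc 8 (by norm_num) (by norm_num),
    hc 9 (by norm_num) (by norm_num),
    hc 10 (by norm_num) (by norm_num),
    hc 11 (by norm_num) (by norm_num),
    hc 12 (by norm_num) (by norm_num)]
  norm_num
  simp only [map_ofNat]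
  ring

/-- **`E₈′ = 2πi(-8 * q ^ 8) + o(q¹²)`.** [folklore] -/
theorem tendsto_deriv_eulerFn_eight_twelve :
    Tendsto (fun τ : ℍ ↦ (deriv (eulerFn 8 ∘ ofComplex) τ
      - (C (2 * π * I) * (-8 * X ^ 8) : ℂ[X]).eval (Function.Periodic.qParam 1 (τ : ℂ)))
      / Function.Periodic.qParam 1 (τ : ℂ) ^ 12) atImInfty (𝓝 0) := by
  refine congr_poly ?_ (congr_fun (fun τ ↦ deriv_eulerFn_sub_one 8 τ)
    (tendsto_deriv_of_isCuspFunction (isCuspFunction_eulerFn_sub_one (by norm_num : 0 < 8)) 12))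
  have h := coeff_formalEulerScaled_eight_le_thirtyTwo
  have hc : ∀ n : ℕ, n ≠ 0 → n ≤ 12 → (qExpansion 1 (eulerFn 8 - 1)).coeff n
      = (((if n = 0 then 1 else if n = 8 then -1 else if n = 16 then -1 else 0 : ℤ)) : ℂ) :=
    fun n hn hnM ↦ by rw [qExpansion_eulerFn_sub_one_coeff_of_ne_zero (by norm_num) hn, h n (by omega)]
  simp only [Finset.sum_range_succ, Finset.sum_range_zero, hc 1 (by norm_num) (by norm_num),
    hc 2 (by norm_num) (by norm_num),
    hc 3 (by norm_num) (by norm_num),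
    hc 4 (by norm_num) (by norm_num),
    hc 5 (by norm_num) (by norm_num),
    hc 6 (by norm_num) (by norm_num),
    hc 7 (by norm_num) (by norm_num),
    hc 8 (by norm_num) (by norm_num),
    hc 9 (by norm_num) (by norm_num),
    hc 10 (by norm_num) (by norm_num),
    hc 11 (by norm_num) (by norm_num),
    hc 12 (by norm_num) (by norm_num)]
  norm_num
  simp only [map_ofNat]
  ring

end Summit.BirchSwinnertonDyer.BirchSwinnertonDyer.Theorems.ManinLocalTwoThree.EulerRemaindersFiftySix

end
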